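import Mathlib
import HarnessLib
import Summits.HubbardSuperconductivity.HubbardSuperconductivity.Theorems.KLProgrammeH10TwoPointLimitPerturbedFermiRadiusSmooth
import Summits.HubbardSuperconductivity.HubbardSuperconductivity.Theorems.KLProgrammePerturbedFermiCurveLevelChain

/-!
# Route `KLProgramme` — the perturbed Fermi curve at THIRD and FOURTH order: the derivative tower of a polar curve
# `θ ↦ u θ • dir θ` and the sharp graded bounds `|u″|, |u‴|, |u⁗|` of a `C⁴` polar level curve

Cell `gate-hubbard-kl`, seat hubbard-kl-k3c3-p3 (g2; row «implicit-function / monotonicity route»).  Companion of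
`KLProgrammePerturbedFermiCurveLevelChain.lean` (the differentiated level identities to order four on a normed space and their pointwise
solution).  WHY: the ENGINE child of crux K3 (stmt-HubbardSuperconductivity-19823) certifies (E3g) `TwoLegAngularG` (`j ≤ 4`) and the
tier-2 sizes (E3a-G) of objects read on the frame's Fermi curve `θ ↦ klFermiPoint μ K θ = u_K(θ) • dir θ`; by the chain rule every
such bound meets `‖∂_θ^i (u_K • dir)‖`, `i ≤ 4`, quantitatively, and the tree had `i ≤ 2` only (`abs_deriv_le`, `abs_second_deriv_le`).

* §3 POLAR CURVES (`Fin 2 → ℝ`, sup norm, `‖dir‖_∞ ≤ 1`): `(d/dθ) dir (θ + π/2) = -dir θ`; the derivative of a moving-frame combination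
  `(a•d₀ + b•d₁)′ = (a′ − b)•d₀ + (b′ + a)•d₁` (`d₀ = dir θ`, `d₁ = dir (θ + π/2)`); hence for `u ∈ C⁴` the tower
  `k₁ = u′d₀ + u d₁`, `k₂ = (u″ − u)d₀ + 2u′d₁`, `k₃ = (u‴ − 3u′)d₀ + (3u″ − u)d₁`, `k₄ = (u⁗ − 6u″ + u)d₀ + 4(u‴ − u′)d₁`
  (`hasDerivAt_polar_zero/one/two/three`) and `‖a•d₀ + b•d₁‖ ≤ |a| + |b|`.
* §4 ASSEMBLY.  For `e : (Fin 2 → ℝ) → ℝ` and `u` of class `C⁴` with `e (u θ • dir θ) = c` for all `θ` and radial transversality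
  `De(u θ • dir θ)[dir θ] ≥ ρ₀ > 0` at the angle `θ`, from pointwise data `|u θ| ≤ U₀`, `|u′ θ| ≤ R₁`, `|u″ θ| ≤ R₂`, `|u‴ θ| ≤ R₃` and
  `‖Dⁱe(u θ • dir θ)‖ ≤ Eᵢ` (nested `fderiv`s, the lineage's convention of `abs_second_deriv_le`):
  `|u″ θ| ≤ (E₂(R₁+U₀)² + E₁(2R₁+U₀))/ρ₀`,
  `|u‴ θ| ≤ (E₃K₁³ + 3E₂K₁K₂ + E₁(3R₂+3R₁+U₀))/ρ₀`,
  `|u⁗ θ| ≤ (E₄K₁⁴ + 6E₃K₁²K₂ + 3E₂K₂² + 4E₂K₁K₃ + E₁(4R₃+6R₂+4R₁+U₀))/ρ₀`,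
  `K₁ = R₁+U₀`, `K₂ = R₂+2R₁+U₀`, `K₃ = R₃+3R₂+3R₁+U₀` — SHARP GRADED form: affine in `E₃` and in `E₄`.

Next modules (same seat): the instantiation `e = ε₀ + δ` under the lineage's hypotheses (`B : BandBounds a b`, `κ₀, …, κ₄`; `E_i ≤ 4 + κ_i`,
`ρ₀ = Dt_min − κ₁`, `U₀ = π√2`) for any root selection / `perturbedFermiRadius` / `klFermiPoint`, the graded corollary `‖k^{(i)}‖ ≤ Dⁱ`
(`i ≤ 4`) consumed by `norm_iteratedFDeriv_comp_le`, and the `FrameOK`-keyed form in the KL regime.  Everything is PROVED; no definitions,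
nothing about the Hubbard model.  References: BGM 2006 §2.4 Lemma 2.1 (2.40) [cite: BenfattoGiulianiMastropietro2006]; FST, CPAM 53 (2000)
1350; HOME/prover-p4/INVERSION-NOTE.md Lemma I.
-/

noncomputable section

namespace Summit.HubbardSuperconductivity.HubbardSuperconductivity.Theorems.PerturbedFermiCurve

set_option linter.dupNamespace false -- summit = problem name (single-conjunct summit), D-0017
set_option maxSynthPendingDepth 3 -- nested operator-norm instances (third/fourth Fréchet derivatives)

open Real Set
open Literature.MathematicalPhysics.QuantumLattice Literature.MathematicalPhysics.QuantumLattice.BandSectorCounting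

/-! ## §3 Polar curves: the derivative tower of `θ ↦ u θ • dir θ` in the moving frame `dir θ`, `dir (θ + π/2)` -/

/-- `(d/dθ) dir (θ + π/2) = -dir θ`. [folklore] -/
theorem hasDerivAt_dir_add_pi_div_two (θ : ℝ) : HasDerivAt (fun ϑ : ℝ => dir (ϑ + π / 2)) (-dir θ) θ := by
  refine hasDerivAt_pi.2 fun i => ?_
  fin_cases i
  · have h : HasDerivAt (fun ϑ : ℝ => -Real.sin ϑ) (-Real.cos θ) θ := (Real.hasDerivAt_sin θ).neg
    simpa [dir, Real.cos_add_pi_div_two] using h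
  · have h : HasDerivAt (fun ϑ : ℝ => Real.cos ϑ) (-Real.sin θ) θ := Real.hasDerivAt_cos θ
    simpa [dir, Real.sin_add_pi_div_two] using h

/-- `‖dir (θ + π/2)‖ ≤ 1`, `‖-dir θ‖ ≤ 1` bookkeeping: the norm of a moving-frame combination `a•dir θ + b•dir(θ + π/2)` is at most
`|a| + |b|` (sup norm). [folklore] -/
theorem norm_frame_comb_le (a b θ : ℝ) : ‖a • dir θ + b • dir (θ + π / 2)‖ ≤ |a| + |b| := by
  refine (norm_add_le _ _).trans (add_le_add ?_ ?_)
  · rw [norm_smul, Real.norm_eq_abs]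
    exact mul_le_of_le_one_right (abs_nonneg a) (norm_dir_le_one θ)
  · rw [norm_smul, Real.norm_eq_abs]
    exact mul_le_of_le_one_right (abs_nonneg b) (norm_dir_le_one _)

/-- **Derivative of a moving-frame combination**: `(a•d₀ + b•d₁)′ = (a′ − b)•d₀ + (b′ + a)•d₁`. [folklore] -/
theorem hasDerivAt_frame_comb {a b : ℝ → ℝ} {a' b' θ : ℝ} (ha : HasDerivAt a a' θ) (hb : HasDerivAt b b' θ) :
    HasDerivAt (fun ϑ => a ϑ • dir ϑ + b ϑ • dir (ϑ + π / 2))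
      ((a' - b θ) • dir θ + (b' + a θ) • dir (θ + π / 2)) θ := by
  have h := (ha.smul (hasDerivAt_dir θ)).add (hb.smul (hasDerivAt_dir_add_pi_div_two θ))
  refine h.congr_deriv ?_
  simp only [smul_neg, sub_smul, add_smul]
  abel

section Polar

variable {u : ℝ → ℝ} (hu : ContDiff ℝ 4 u)
include hu

/-- A `C⁴` function and its first three derivatives are differentiable. [folklore] -/
theorem hasDerivAt_tower_of_contDiff_four (ϑ : ℝ) :
    HasDerivAt u (deriv u ϑ) ϑ ∧ HasDerivAt (deriv u) (deriv (deriv u) ϑ) ϑ ∧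
      HasDerivAt (deriv (deriv u)) (deriv (deriv (deriv u)) ϑ) ϑ ∧
        HasDerivAt (deriv (deriv (deriv u))) (deriv (deriv (deriv (deriv u))) ϑ) ϑ := by
  have h4 : ContDiff ℝ ((3 : WithTop ℕ∞) + 1) u := by norm_num; exact hu
  have h3 : ContDiff ℝ 3 (deriv u) := (contDiff_succ_iff_deriv.1 h4).2.2
  have h3' : ContDiff ℝ ((2 : WithTop ℕ∞) + 1) (deriv u) := by norm_num; exact h3
  have h2 : ContDiff ℝ 2 (deriv (deriv u)) := (contDiff_succ_iff_deriv.1 h3').2.2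
  have h2' : ContDiff ℝ ((1 : WithTop ℕ∞) + 1) (deriv (deriv u)) := by rw [one_add_one_eq_two]; exact h2
  have h1 : ContDiff ℝ 1 (deriv (deriv (deriv u))) := (contDiff_succ_iff_deriv.1 h2').2.2
  exact ⟨((hu.differentiable (by norm_num)) ϑ).hasDerivAt, ((h3.differentiable (by norm_num)) ϑ).hasDerivAt,
    ((h2.differentiable (by norm_num)) ϑ).hasDerivAt, ((h1.differentiable one_ne_zero) ϑ).hasDerivAt⟩

/-- **Velocity**: `(u•d₀)′ = u′•d₀ + u•d₁`. [folklore] -/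
theorem hasDerivAt_polar_zero (ϑ : ℝ) :
    HasDerivAt (fun t => u t • dir t) (deriv u ϑ • dir ϑ + u ϑ • dir (ϑ + π / 2)) ϑ := by
  have h := ((hasDerivAt_tower_of_contDiff_four hu ϑ).1.smul (hasDerivAt_dir ϑ))
  refine h.congr_deriv ?_
  abel

/-- **Acceleration**: `(u′•d₀ + u•d₁)′ = (u″ − u)•d₀ + 2u′•d₁`. [folklore] -/
theorem hasDerivAt_polar_one (ϑ : ℝ) :
    HasDerivAt (fun t => deriv u t • dir t + u t • dir (t + π / 2))
      ((deriv (deriv u) ϑ - u ϑ) • dir ϑ + (2 * deriv u ϑ) • dir (ϑ + π / 2)) ϑ := by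
  obtain ⟨h0, h1, -, -⟩ := hasDerivAt_tower_of_contDiff_four hu ϑ
  refine (hasDerivAt_frame_comb h1 h0).congr_deriv ?_
  rw [two_mul]

/-- **Third derivative of the curve**: `((u″−u)•d₀ + 2u′•d₁)′ = (u‴ − 3u′)•d₀ + (3u″ − u)•d₁`. [folklore] -/
theorem hasDerivAt_polar_two (ϑ : ℝ) :
    HasDerivAt (fun t => (deriv (deriv u) t - u t) • dir t + (2 * deriv u t) • dir (t + π / 2))
      ((deriv (deriv (deriv u)) ϑ - 3 * deriv u ϑ) • dir ϑ + (3 * deriv (deriv u) ϑ - u ϑ) • dir (ϑ + π / 2)) ϑ := by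
  obtain ⟨h0, h1, h2, -⟩ := hasDerivAt_tower_of_contDiff_four hu ϑ
  have ha : HasDerivAt (fun t => deriv (deriv u) t - u t) (deriv (deriv (deriv u)) ϑ - deriv u ϑ) ϑ := h2.sub h0
  have hb : HasDerivAt (fun t => 2 * deriv u t) (2 * deriv (deriv u) ϑ) ϑ := h1.const_mul 2
  refine (hasDerivAt_frame_comb ha hb).congr_deriv ?_
  congr 1
  · congr 1; ring
  · congr 1; ring

/-- **Fourth derivative of the curve**: `((u‴−3u′)•d₀ + (3u″−u)•d₁)′ = (u⁗ − 6u″ + u)•d₀ + (4u‴ − 4u′)•d₁`. [folklore] -/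
theorem hasDerivAt_polar_three (ϑ : ℝ) :
    HasDerivAt (fun t => (deriv (deriv (deriv u)) t - 3 * deriv u t) • dir t + (3 * deriv (deriv u) t - u t) • dir (t + π / 2))
      ((deriv (deriv (deriv (deriv u))) ϑ - 6 * deriv (deriv u) ϑ + u ϑ) • dir ϑ +
        (4 * deriv (deriv (deriv u)) ϑ - 4 * deriv u ϑ) • dir (ϑ + π / 2)) ϑ := by
  obtain ⟨h0, h1, h2, h3⟩ := hasDerivAt_tower_of_contDiff_four hu ϑ
  have ha : HasDerivAt (fun t => deriv (deriv (deriv u)) t - 3 * deriv u t)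
      (deriv (deriv (deriv (deriv u))) ϑ - 3 * deriv (deriv u) ϑ) ϑ := h3.sub (h1.const_mul 3)
  have hb : HasDerivAt (fun t => 3 * deriv (deriv u) t - u t) (3 * deriv (deriv (deriv u)) ϑ - deriv u ϑ) ϑ :=
    (h2.const_mul 3).sub h0
  refine (hasDerivAt_frame_comb ha hb).congr_deriv ?_
  congr 1
  · congr 1; ring
  · congr 1; ring

end Polar

/-! ## §4 Assembly: the radial derivatives of a `C⁴` polar level curve of a `C⁴` function -/

section Assembly

variable {e : (Fin 2 → ℝ) → ℝ} (he : ContDiff ℝ 4 e) {u : ℝ → ℝ} (hu : ContDiff ℝ 4 u) {c : ℝ}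
  (hlev : ∀ ϑ, e (u ϑ • dir ϑ) = c)
include he hu hlev

/-- **Order 2** (second angular derivative of the radius): with `|u θ| ≤ U₀`, `|u′ θ| ≤ R₁`, `De(p)[dir θ] ≥ ρ₀ > 0` at
`p = u θ • dir θ`, `‖De(p)‖ ≤ E₁`, `‖D²e(p)‖ ≤ E₂`: `|u″(θ)| ≤ (E₂ (R₁+U₀)² + E₁ (2R₁+U₀))/ρ₀`. [folklore] -/
theorem abs_deriv_two_le_of_polar_level {θ ρ₀ E₁ E₂ U₀ R₁ : ℝ} (hρ0 : 0 < ρ₀)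
    (hρ : ρ₀ ≤ fderiv ℝ e (u θ • dir θ) (dir θ)) (hE₁ : ‖fderiv ℝ e (u θ • dir θ)‖ ≤ E₁)
    (hE₂ : ‖fderiv ℝ (fderiv ℝ e) (u θ • dir θ)‖ ≤ E₂) (hU₀ : |u θ| ≤ U₀) (hR₁ : |deriv u θ| ≤ R₁) :
    |deriv (deriv u) θ| ≤ (E₂ * (R₁ + U₀) ^ 2 + E₁ * (2 * R₁ + U₀)) / ρ₀ := by
  have hid := level_chain_two (k₀ := fun t => u t • dir t) (he.of_le (by norm_num)) hlev (hasDerivAt_polar_zero hu)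
    (hasDerivAt_polar_one hu) θ
  have h2u : |2 * deriv u θ| ≤ 2 * R₁ := by rw [abs_mul, abs_two]; linarith
  have hnu : |(-u θ)| ≤ U₀ := by rw [abs_neg]; exact hU₀
  refine abs_top_le_of_level_two _ _ hid (d := dir θ) (r := (-u θ) • dir θ + (2 * deriv u θ) • dir (θ + π / 2)) ?_ hρ hρ0
    hE₁ hE₂ ((norm_frame_comb_le _ _ θ).trans (by linarith)) ((norm_frame_comb_le _ _ θ).trans (by linarith))
  simp only [sub_smul, neg_smul]; abel

/-- **Order 3** (third angular derivative of the radius): with `K₁ = R₁+U₀`, `K₂ = R₂+2R₁+U₀`,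
`|u‴(θ)| ≤ (E₃K₁³ + 3E₂K₁K₂ + E₁(3R₂+3R₁+U₀))/ρ₀`. [cite: BenfattoGiulianiMastropietro2006, §2.4 Lemma 2.1 (2.40)] -/
theorem abs_deriv_three_le_of_polar_level {θ ρ₀ E₁ E₂ E₃ U₀ R₁ R₂ : ℝ} (hρ0 : 0 < ρ₀)
    (hρ : ρ₀ ≤ fderiv ℝ e (u θ • dir θ) (dir θ)) (hE₁ : ‖fderiv ℝ e (u θ • dir θ)‖ ≤ E₁)
    (hE₂ : ‖fderiv ℝ (fderiv ℝ e) (u θ • dir θ)‖ ≤ E₂) (hE₃ : ‖fderiv ℝ (fderiv ℝ (fderiv ℝ e)) (u θ • dir θ)‖ ≤ E₃)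
    (hU₀ : |u θ| ≤ U₀) (hR₁ : |deriv u θ| ≤ R₁) (hR₂ : |deriv (deriv u) θ| ≤ R₂) :
    |deriv (deriv (deriv u)) θ| ≤
      (E₃ * (R₁ + U₀) ^ 3 + 3 * E₂ * (R₁ + U₀) * (R₂ + 2 * R₁ + U₀) + E₁ * (3 * R₂ + 3 * R₁ + U₀)) / ρ₀ := by
  have hid := level_chain_three (k₀ := fun t => u t • dir t) (he.of_le (by norm_num)) hlev (hasDerivAt_polar_zero hu)
    (hasDerivAt_polar_one hu) (hasDerivAt_polar_two hu) θ
  have h2u : |2 * deriv u θ| ≤ 2 * R₁ := by rw [abs_mul, abs_two]; linarith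
  have hau : |deriv (deriv u) θ - u θ| ≤ R₂ + U₀ := (abs_sub _ _).trans (by linarith)
  have h3u : |(-(3 * deriv u θ))| ≤ 3 * R₁ := by
    rw [abs_neg, abs_mul, show |(3 : ℝ)| = 3 by norm_num]; linarith
  have hbu : |3 * deriv (deriv u) θ - u θ| ≤ 3 * R₂ + U₀ := by
    refine (abs_sub _ _).trans ?_
    rw [abs_mul, show |(3 : ℝ)| = 3 by norm_num]; linarith
  refine abs_top_le_of_level_three _ _ _ hid (d := dir θ)
    (r := (-(3 * deriv u θ)) • dir θ + (3 * deriv (deriv u) θ - u θ) • dir (θ + π / 2)) ?_ hρ hρ0 hE₁ hE₂ hE₃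
    ((norm_frame_comb_le _ _ θ).trans (by linarith)) ((norm_frame_comb_le _ _ θ).trans (by linarith))
    ((norm_frame_comb_le _ _ θ).trans (by linarith))
  simp only [sub_smul, neg_smul]; abel

/-- **Order 4** (fourth angular derivative of the radius): with `K₁ = R₁+U₀`, `K₂ = R₂+2R₁+U₀`, `K₃ = R₃+3R₂+3R₁+U₀`,
`|u⁗(θ)| ≤ (E₄K₁⁴ + 6E₃K₁²K₂ + 3E₂K₂² + 4E₂K₁K₃ + E₁(4R₃+6R₂+4R₁+U₀))/ρ₀`. [cite: BenfattoGiulianiMastropietro2006, §2.4 Lemma 2.1 (2.40)] -/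
theorem abs_deriv_four_le_of_polar_level {θ ρ₀ E₁ E₂ E₃ E₄ U₀ R₁ R₂ R₃ : ℝ} (hρ0 : 0 < ρ₀)
    (hρ : ρ₀ ≤ fderiv ℝ e (u θ • dir θ) (dir θ)) (hE₁ : ‖fderiv ℝ e (u θ • dir θ)‖ ≤ E₁)
    (hE₂ : ‖fderiv ℝ (fderiv ℝ e) (u θ • dir θ)‖ ≤ E₂) (hE₃ : ‖fderiv ℝ (fderiv ℝ (fderiv ℝ e)) (u θ • dir θ)‖ ≤ E₃)
    (hE₄ : ‖fderiv ℝ (fderiv ℝ (fderiv ℝ (fderiv ℝ e))) (u θ • dir θ)‖ ≤ E₄)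
    (hU₀ : |u θ| ≤ U₀) (hR₁ : |deriv u θ| ≤ R₁) (hR₂ : |deriv (deriv u) θ| ≤ R₂) (hR₃ : |deriv (deriv (deriv u)) θ| ≤ R₃) :
    |deriv (deriv (deriv (deriv u))) θ| ≤
      (E₄ * (R₁ + U₀) ^ 4 + 6 * E₃ * (R₁ + U₀) ^ 2 * (R₂ + 2 * R₁ + U₀) + 3 * E₂ * (R₂ + 2 * R₁ + U₀) ^ 2 +
          4 * E₂ * (R₁ + U₀) * (R₃ + 3 * R₂ + 3 * R₁ + U₀) + E₁ * (4 * R₃ + 6 * R₂ + 4 * R₁ + U₀)) / ρ₀ := by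
  have hid := level_chain_four (k₀ := fun t => u t • dir t) he hlev (hasDerivAt_polar_zero hu)
    (hasDerivAt_polar_one hu) (hasDerivAt_polar_two hu) (hasDerivAt_polar_three hu) θ
  have h2u : |2 * deriv u θ| ≤ 2 * R₁ := by rw [abs_mul, abs_two]; linarith
  have hau : |deriv (deriv u) θ - u θ| ≤ R₂ + U₀ := (abs_sub _ _).trans (by linarith)
  have ha3 : |deriv (deriv (deriv u)) θ - 3 * deriv u θ| ≤ R₃ + 3 * R₁ := by
    refine (abs_sub _ _).trans ?_
    rw [abs_mul, show |(3 : ℝ)| = 3 by norm_num]; linarith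
  have hb3 : |3 * deriv (deriv u) θ - u θ| ≤ 3 * R₂ + U₀ := by
    refine (abs_sub _ _).trans ?_
    rw [abs_mul, show |(3 : ℝ)| = 3 by norm_num]; linarith
  have ha4 : |(-(6 * deriv (deriv u) θ) + u θ)| ≤ 6 * R₂ + U₀ := by
    refine (abs_add_le _ _).trans ?_
    rw [abs_neg, abs_mul, show |(6 : ℝ)| = 6 by norm_num]; linarith
  have hb4 : |4 * deriv (deriv (deriv u)) θ - 4 * deriv u θ| ≤ 4 * R₃ + 4 * R₁ := by
    refine (abs_sub _ _).trans ?_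
    rw [abs_mul, abs_mul, show |(4 : ℝ)| = 4 by norm_num]; linarith
  refine abs_top_le_of_level_four _ _ _ _ hid (d := dir θ)
    (r := (-(6 * deriv (deriv u) θ) + u θ) • dir θ + (4 * deriv (deriv (deriv u)) θ - 4 * deriv u θ) • dir (θ + π / 2))
    ?_ hρ hρ0 hE₁ hE₂ hE₃ hE₄
    ((norm_frame_comb_le _ _ θ).trans (by linarith)) ((norm_frame_comb_le _ _ θ).trans (by linarith))
    ((norm_frame_comb_le _ _ θ).trans (by linarith)) ((norm_frame_comb_le _ _ θ).trans (by linarith))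
  simp only [sub_smul, add_smul, neg_smul]; abel

end Assembly

end Summit.HubbardSuperconductivity.HubbardSuperconductivity.Theorems.PerturbedFermiCurve

end
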